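import Summits.QuantumFields.YangMills.Theorems.UnitScaleTiltProp7RowHOfLocalModelRows
import Summits.QuantumFields.YangMills.Theorems.UnitScaleTiltProp7CoclosedEnergiesOfHKgK
import HarnessLib

/-!
# Route `UnitScaleTilt`, crux K1 child «MinimiserStabilityRegPr» (stmt-QuantumFields-19200) — route-R E′, growth side: THE E′ DISPLAY AFTER THE R5 KNITS.
# E′ ⇐ (E1) the pinned slice theorem ∧ hKg-K ∧ {hRes, hDir, hGJ} ∧ (P) — the R5 door ✓`Prop7ZetaRowOfEngineRows` with rows (H) and (B) DISCHARGED by kernel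
# (✓`Prop7RowHOfLocalModelRows.rowH_of_localModelRows`, ✓`Prop7CoclosedEnergiesOfHKgK.rowB_of_hKgK_T3` (px12)), member arithmetic and `S_H ⇒ Δ_W²φ₀ = 0` included

Cell `ym3-torus` ∕ fleet seat `ym-ust-19200-p1` (gen 16, route-R E′ lead ∕ namer).  THEOREMS ONLY (0 `def`, 0 `sorry`); `--supports stmt-QuantumFields-19200`, count-neutral.
YM₃ on T³ is a ladder rung (R3), not the Clay problem; nothing here claims the stub, the crux, d = 4 or the mass gap; E′ is NOT closed by this file — its rows are DISPLAYED.

WHY.  ✓p677112 reduced (S3) to three booked rows (H)(P)(B) on a co-closed covariant Hodge split of the chart; ✓p677598 reduced (H) to LEMMA-H-CURVED with free local models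
(✓p666125) plus three displayed local-model rows; ✓p677648 (px12 g4) reduced (B) to the single displayed row hKg-K.  This file composes the three by kernel, discharging on the way:
the member arithmetic (`(F.P K).m + (F.P K).K ≥ K − n`, `2 ≤ L^(K−n)` from `1 < L`, `n < K`), the plaquette clause `dist1(W(∂p)) ≤ e·ℓ⁻²` (✓`dist1_plaqHol_le_of_mem_regFibrePr`), `e ≤ 1`
(from `10¹⁴L⁹e₆ ≤ 1`), and the passage from the door's `S_H` letter to LEMMA-H's biharmonic letter (✓`covLapLap_eq_zero_of_split`).  What remains DISPLAYED per member, for every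
co-closed split `D = B + D_Wφ₀` of the chart of an exactly `S_H`-gauged fibre point of an R2-critical `W`:
* hKg-K — `K_W(D_Wφ₀) ≤ C_g·K + θ_g·e·ℓ⁻²·M` (the local commutator energy of the Hodge potential; numerically `C_g ≈ 0.06–0.11` at constrained critical points, (N1));
* hRes, hDir, hGJ — for SOME local models `Ψ_y` of the centre data (`Ψ_y(c_y) = φ₀(c_y)`) with recentring data `Z`, `G`: the Laplacian group `6·LAP(Ψ) ≤ ζ_R K + θ_R e ℓ⁻² M`, the
  Dirichlet group `2c_D(ℓ)·DIR(Ψ) ≤ ζ_D K + θ_D e ℓ⁻² M`, the junction `2c_G(ℓ)·Σ_y G_y² ≤ C_H ℓ⁻¹ δ^V(φ₀) + ζ_G K + θ_G e ℓ⁻² M` ((N3) columns, px8 g3);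
* (P) — `δ^V(φ₀) ≤ ℓ(ζ_P∕θ)K + θℓ⁻¹M + θ_P e ℓ⁻¹M + C_P ℓ G_W(B) + C_Λ ℓ CURL_HS(B)` (px17's R3′ chain: ✓p669468 door + ✓p666871 + BLOCK-GAUSS + Σ₁ + J_VH + T-F + defect);
plus (E1) and the windows of ✓p666280 VERBATIM, and the two constant inequalities `C_Hζ_P∕θ + (ζ_R+ζ_D+ζ_G) + C_H(C_P+C_Λ)·16(1+C_g) ≤ ζ`,
`C_Hθ + e₆(C_Hθ_P + (θ_R+θ_D+θ_G) + C_H(C_P+C_Λ)(16θ_g + 792)) ≤ δ₁`.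

WHAT IS PROVED (ns `…Theorems.Prop7PV3EOfPinnedSliceAndRawRows`): ★★★ `stub_PV3E_of_pinnedSliceAndRawRows` (E′ text VERBATIM).
HONEST SCOPE.  Composition of landed theorems; every analytic row is DISPLAYED; hKg-K∕hRes∕hDir∕hGJ are inhabited numerically only; no constant of Bałaban's is asserted.

References: T. Bałaban, CMP 102 (1985) 277–309 [Balaban1985Variational] ((4)–(7) p.278, (116) p.295, (141)–(143), Prop. 7 p.299); CMP 99 (1985) 389–434
[Balaban1985BackgroundPropagators] ((3.3)–(3.4) pp.390–391, (3.8)–(3.11) p.392, Thm 3.11 p.416); CMP 99 (1985) 75–102 [Balaban1985RegularSpaces] ((1.14) p.78, Thm 2 p.83);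
CMP 95 (1984) 17–40 [Balaban1984PropagatorsI] ((1.21) p.21, Prop. 1.1 (1.90) p.33).
-/

set_option autoImplicit false
noncomputable section

open scoped BigOperators Matrix.Norms.L2Operator Matrix

namespace Summit.QuantumFields.YangMills.Theorems.Prop7PV3EOfPinnedSliceAndRawRows

open Literature.MathematicalPhysics.QuantumFieldTheory.Balaban1983to89
open Literature.MathematicalPhysics.QuantumFieldTheory.Balaban1983to89.T3ContinuumYM3Torus
open Literature.MathematicalPhysics.QuantumFieldTheory.Balaban1983to89.T3Thm1Carrier
open Literature.MathematicalPhysics.QuantumFieldTheory.Balaban1983to89.T3PrintedRegularMinimiser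
open Literature.MathematicalPhysics.QuantumFieldTheory.Balaban1983to89.T3RegularMinimiser
open Literature.MathematicalPhysics.QuantumFieldTheory.Balaban1983to89.T3Thm1CarrierNative (IsCritR2)
open Literature.MathematicalPhysics.QuantumFieldTheory.Balaban1983to89.T3SectALandauChart (CloseAvg)
open T4Continuum BlockAveraging AveragingRT ExpMeanLog
open MatrixLog (mlog)
open B9Eq39Adjoint (R covD covDstar divB curl)
open B10Eq27TorusAxialLog (unitsField toUField)
open B9TorusCalculus (torusT)
open B5Eq118OneStroke (iterBlockOf)
open B15DeterminingSets (embIter)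
open Summit.QuantumFields.YangMills.Theorems.Prop7ZetaRowOfEngineRows (stub_PV3E_of_pinnedSliceAndEngineRows)
open Summit.QuantumFields.YangMills.Theorems.Prop7RowHOfLocalModelRows (rowH_of_localModelRows covLapLap_eq_zero_of_split)
open Summit.QuantumFields.YangMills.Theorems.Prop7CoclosedEnergiesOfHKgK (rowB_of_hKgK_T3 dist1_plaqHol_le_of_mem_regFibrePr)

set_option maxHeartbeats 400000 in
/-- ★★★ **E′ ⇐ (E1) ∧ hKg-K ∧ {hRes, hDir, hGJ} ∧ (P).**  Per `L > 1`: `e₆ sQ ζ δ₁` with the windows of ✓p666280 VERBATIM, the pinned slice theorem (E1) VERBATIM, and constants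
`C_H ζ_R θ_R ζ_D θ_D ζ_G θ_G ζ_P θ θ_P C_P C_Λ C_g θ_g` (signs, the two bookkeeping inequalities) such that at every member and every co-closed covariant Hodge split of the chart of an
exactly `S_H`-gauged fibre point of an R2-critical `W ∈ (6)(e) ∩ 𝔅_k(V)` the DISPLAYED rows hKg-K, hRes∕hDir∕hGJ (for some local models) and (P) hold.  CONCLUSION = the E′ text.
[cite: Balaban1985Variational, (141)-(143) p.299, Prop. 7 p.299, (4)-(7) p.278, (116) p.295; Balaban1985BackgroundPropagators, (3.3)-(3.4) pp.390-391, (3.8)-(3.11) p.392, Thm 3.11 p.416; Balaban1985RegularSpaces, (1.14) p.78, Thm 2 p.83; Balaban1984PropagatorsI, Prop. 1.1 (1.90) p.33] -/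
theorem stub_PV3E_of_pinnedSliceAndRawRows
    (hrows : ∀ (L : ℕ), 1 < L → ∃ e₆ sQ ζ δ₁ : ℝ, 0 < e₆ ∧ 100000000000000 * (L : ℝ) ^ 9 * e₆ ≤ 1 ∧ 0 ≤ sQ ∧ 8 * sQ ≤ 1 ∧
      800000000000 * (L : ℝ) ^ 9 * sQ ≤ 1 ∧ 0 ≤ ζ ∧ 0 ≤ δ₁ ∧ δ₁ < 4 * (1 / (128 * (18 + 537600 * (L : ℝ) ^ 4))) ∧
      16 * e₆ * ((8 * ((3 / 2) * (694800 * (L : ℝ) ^ 5) * (28800 * (L : ℝ) ^ 4) * ((L : ℝ) ^ 2 / ((L : ℝ) ^ 3 - 1)))) * (1 + ζ)) ≤ 1 ∧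
      15552 * (2 * sQ) ^ 2 + 216 * e₆ + 2 * e₆ * ((2 * ((3 / 2) * (694800 * (L : ℝ) ^ 5) * (7 * ((L : ℝ) ^ 2 / ((L : ℝ) - 1)) + 600000 * (L : ℝ) ^ 4 * ((L : ℝ) ^ 2 / ((L : ℝ) ^ 3 - 1)))) + 322608 * ((3 / 2) * (694800 * (L : ℝ) ^ 5) * (28800 * (L : ℝ) ^ 4) * ((L : ℝ) ^ 2 / ((L : ℝ) ^ 3 - 1))))
        + (8 * ((3 / 2) * (694800 * (L : ℝ) ^ 5) * (28800 * (L : ℝ) ^ 4) * ((L : ℝ) ^ 2 / ((L : ℝ) ^ 3 - 1)))) * δ₁)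
        ≤ (((1 / (128 * (18 + 537600 * (L : ℝ) ^ 4))) - δ₁ / 4) / (1 + ζ / 4)) / 8 ∧
      -- (E1) the pinned slice theorem: an exactly S_H-gauged fibre point per competitor
      (∀ (F : T3Family), F.L = L → ∀ (n K : ℕ) (hnK : n < K) (e : ℝ) (V : GaugeField (F.P n) 0 (Matrix.specialUnitaryGroup (Fin 2) ℂ))
        (W : GaugeField (F.P K) 0 (Matrix.specialUnitaryGroup (Fin 2) ℂ)),
        0 < e → e ≤ e₆ → W ∈ regFibrePr F n K hnK.le e V → IsCritR2 F n K hnK.le V W →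
        ∀ W' : GaugeField (F.P K) 0 (Matrix.specialUnitaryGroup (Fin 2) ℂ), W' ∈ regFibrePr F n K hnK.le e V →
          ∃ Y : GaugeField (F.P K) 0 (Matrix.specialUnitaryGroup (Fin 2) ℂ), Y ∈ regFibrePr F n K hnK.le e V ∧ wilsonAction4 W' = wilsonAction4 Y ∧
            (∀ b : PBond (F.P K) 0, ‖((Y b * (W b)⁻¹ : Matrix.specialUnitaryGroup (Fin 2) ℂ) : Matrix (Fin 2) (Fin 2) ℂ) - 1‖
              ≤ sQ * ((F.L : ℝ) ^ (K - n))⁻¹) ∧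
            (∀ x : Site (F.P K) 0, x ∉ Set.range (embIter (K - n)) →
              divB (torusT (F.P K) 0) (fun κ z => unitsField (toUField W) ⟨z, κ⟩)
                (fun μ z => covD (torusT (F.P K) 0) (fun κ z => unitsField (toUField W) ⟨z, κ⟩) μ
                  (fun y => divB (torusT (F.P K) 0) (fun κ z => unitsField (toUField W) ⟨z, κ⟩)
                    (fun κ z => Complex.I • ((-Complex.I) • mlog ((Y ⟨z, κ⟩ * (W ⟨z, κ⟩)⁻¹ : Matrix.specialUnitaryGroup (Fin 2) ℂ) : Matrix (Fin 2) (Fin 2) ℂ))) y) z) x = 0)) ∧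
      -- (S3) REPLACED BY: hKg-K ∧ {hRes, hDir, hGJ} ∧ (P)
      (∃ C_H ζ_R θ_R ζ_D θ_D ζ_G θ_G ζ_P θ θ_P C_P C_Λ C_g θ_g : ℝ,
        0 ≤ C_H ∧ 0 ≤ θ_R ∧ 0 ≤ θ_D ∧ 0 ≤ θ_G ∧ 0 < θ ∧ 0 ≤ θ_P ∧ 0 ≤ C_P ∧ 0 ≤ C_Λ ∧ 0 ≤ θ_g ∧
        C_H * ζ_P / θ + (ζ_R + ζ_D + ζ_G) + C_H * (C_P + C_Λ) * (16 * (1 + C_g)) ≤ ζ ∧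
        C_H * θ + e₆ * (C_H * θ_P + (θ_R + θ_D + θ_G) + C_H * (C_P + C_Λ) * (16 * θ_g + 792)) ≤ δ₁ ∧
      ∀ (F : T3Family), F.L = L → ∀ (n K : ℕ) (hnK : n < K) (e : ℝ) (V : GaugeField (F.P n) 0 (Matrix.specialUnitaryGroup (Fin 2) ℂ))
        (W : GaugeField (F.P K) 0 (Matrix.specialUnitaryGroup (Fin 2) ℂ)),
        0 < e → e ≤ e₆ → W ∈ regFibrePr F n K hnK.le e V → IsCritR2 F n K hnK.le V W →
        ∀ Y : GaugeField (F.P K) 0 (Matrix.specialUnitaryGroup (Fin 2) ℂ), Y ∈ regFibrePr F n K hnK.le e V →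
          (∀ b : PBond (F.P K) 0, ‖((Y b * (W b)⁻¹ : Matrix.specialUnitaryGroup (Fin 2) ℂ) : Matrix (Fin 2) (Fin 2) ℂ) - 1‖
              ≤ sQ * ((F.L : ℝ) ^ (K - n))⁻¹) →
          (∀ x : Site (F.P K) 0, x ∉ Set.range (embIter (K - n)) →
              divB (torusT (F.P K) 0) (fun κ z => unitsField (toUField W) ⟨z, κ⟩)
                (fun μ z => covD (torusT (F.P K) 0) (fun κ z => unitsField (toUField W) ⟨z, κ⟩) μ
                  (fun y => divB (torusT (F.P K) 0) (fun κ z => unitsField (toUField W) ⟨z, κ⟩)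
                    (fun κ z => Complex.I • ((-Complex.I) • mlog ((Y ⟨z, κ⟩ * (W ⟨z, κ⟩)⁻¹ : Matrix.specialUnitaryGroup (Fin 2) ℂ) : Matrix (Fin 2) (Fin 2) ℂ))) y) z) x = 0) →
          ∀ D : PBond (F.P K) 0 → Matrix (Fin 2) (Fin 2) ℂ,
            D = (fun b => (-Complex.I) • mlog ((Y b * (W b)⁻¹ : Matrix.specialUnitaryGroup (Fin 2) ℂ) : Matrix (Fin 2) (Fin 2) ℂ)) →
          ∀ (B : PBond (F.P K) 0 → Matrix (Fin 2) (Fin 2) ℂ) (φ₀ : Site (F.P K) 0 → Matrix (Fin 2) (Fin 2) ℂ),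
            (∀ b : PBond (F.P K) 0, D b = B b + covD (torusT (F.P K) 0) (fun κ z => unitsField (toUField W) ⟨z, κ⟩) b.dir φ₀ b.src) →
            (∀ x : Site (F.P K) 0, divB (torusT (F.P K) 0) (fun κ z => unitsField (toUField W) ⟨z, κ⟩) (fun κ z => B ⟨z, κ⟩) x = 0) →
            -- hKg-K at `IsCritR2 W` (DISPLAYED; numerically `C_g ≈ 0.1` at constrained critical points): the local commutator energy of the Hodge potential
            (∀ Dφ : PBond (F.P K) 0 → Matrix (Fin 2) (Fin 2) ℂ, (∀ b : PBond (F.P K) 0, Dφ b = covD (torusT (F.P K) 0) (fun κ z => unitsField (toUField W) ⟨z, κ⟩) b.dir φ₀ b.src) →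
              (∑ p : Plaq (F.P K) 0, ‖((Complex.I • Dφ ⟨p.src, p.μ⟩) + ((W ⟨p.src, p.μ⟩ : Matrix (Fin 2) (Fin 2) ℂ) * (Complex.I • Dφ ⟨p.src.shift p.μ, p.ν⟩) * star (W ⟨p.src, p.μ⟩ : Matrix (Fin 2) (Fin 2) ℂ))
            - (((W ⟨p.src, p.μ⟩ * W ⟨p.src.shift p.μ, p.ν⟩ * (W ⟨p.src.shift p.ν, p.μ⟩)⁻¹ : Matrix.specialUnitaryGroup (Fin 2) ℂ) : Matrix (Fin 2) (Fin 2) ℂ) * (Complex.I • Dφ ⟨p.src.shift p.ν, p.μ⟩) * star ((W ⟨p.src, p.μ⟩ * W ⟨p.src.shift p.μ, p.ν⟩ * (W ⟨p.src.shift p.ν, p.μ⟩)⁻¹ : Matrix.specialUnitaryGroup (Fin 2) ℂ) : Matrix (Fin 2) (Fin 2) ℂ))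
            - (((GaugeField.plaqHol W p : Matrix.specialUnitaryGroup (Fin 2) ℂ) : Matrix (Fin 2) (Fin 2) ℂ) * (Complex.I • Dφ ⟨p.src, p.ν⟩) * star ((GaugeField.plaqHol W p : Matrix.specialUnitaryGroup (Fin 2) ℂ) : Matrix (Fin 2) (Fin 2) ℂ)))‖ ^ 2)
                ≤ C_g * (∑ p : Plaq (F.P K) 0, ‖((Complex.I • D ⟨p.src, p.μ⟩) + ((W ⟨p.src, p.μ⟩ : Matrix (Fin 2) (Fin 2) ℂ) * (Complex.I • D ⟨p.src.shift p.μ, p.ν⟩) * star (W ⟨p.src, p.μ⟩ : Matrix (Fin 2) (Fin 2) ℂ))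
            - (((W ⟨p.src, p.μ⟩ * W ⟨p.src.shift p.μ, p.ν⟩ * (W ⟨p.src.shift p.ν, p.μ⟩)⁻¹ : Matrix.specialUnitaryGroup (Fin 2) ℂ) : Matrix (Fin 2) (Fin 2) ℂ) * (Complex.I • D ⟨p.src.shift p.ν, p.μ⟩) * star ((W ⟨p.src, p.μ⟩ * W ⟨p.src.shift p.μ, p.ν⟩ * (W ⟨p.src.shift p.ν, p.μ⟩)⁻¹ : Matrix.specialUnitaryGroup (Fin 2) ℂ) : Matrix (Fin 2) (Fin 2) ℂ))
            - (((GaugeField.plaqHol W p : Matrix.specialUnitaryGroup (Fin 2) ℂ) : Matrix (Fin 2) (Fin 2) ℂ) * (Complex.I • D ⟨p.src, p.ν⟩) * star ((GaugeField.plaqHol W p : Matrix.specialUnitaryGroup (Fin 2) ℂ) : Matrix (Fin 2) (Fin 2) ℂ)))‖ ^ 2)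
                  + θ_g * e * (((F.L : ℝ) ^ (K - n)) ^ 2)⁻¹ * (∑ b : PBond (F.P K) 0, ‖D b‖ ^ 2)) ∧
            -- the three LOCAL-MODEL rows of LEMMA-H-CURVED (DISPLAYED): hRes, hDir, hGJ for SOME local models `Ψ` of the centre data of `φ₀`
            (∃ (Ψ : Site (F.P K) (K - n) → Site (F.P K) 0 → Matrix (Fin 2) (Fin 2) ℂ)
                (Z : Fin (F.P K).d → Site (F.P K) 0 → Matrix (Fin 2) (Fin 2) ℂ) (G : Site (F.P K) (K - n) → ℝ),
              (∀ y, Ψ y (embIter (K - n) y) = φ₀ (embIter (K - n) y)) ∧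
              (∀ (y : Site (F.P K) (K - n)) (z : Site (F.P K) 0),
      (∀ ν : Fin (F.P K).d,
        (y ν = (iterBlockOf (K - n) (fun κ => z κ - (((((F.P K).L ^ (K - n) - 1) / 2 : ℕ)) : ZMod ((F.P K).sitesPerDir 0)))) ν - 1
        ∨ y ν = (iterBlockOf (K - n) (fun κ => z κ - (((((F.P K).L ^ (K - n) - 1) / 2 : ℕ)) : ZMod ((F.P K).sitesPerDir 0)))) ν
        ∨ y ν = (iterBlockOf (K - n) (fun κ => z κ - (((((F.P K).L ^ (K - n) - 1) / 2 : ℕ)) : ZMod ((F.P K).sitesPerDir 0)))) ν + 1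
        ∨ y ν = (iterBlockOf (K - n) (fun κ => z κ - (((((F.P K).L ^ (K - n) - 1) / 2 : ℕ)) : ZMod ((F.P K).sitesPerDir 0)))) ν + 2)) →
      ∀ μ : Fin (F.P K).d, ‖Ψ y z - Z μ z‖ ≤ G y) ∧
              6 * (∑ y : Site (F.P K) (K - n), ∑ z : Site (F.P K) 0,
            (if (∀ ν : Fin (F.P K).d,
                (y ν = (iterBlockOf (K - n) (fun κ => z κ - (((((F.P K).L ^ (K - n) - 1) / 2 : ℕ)) : ZMod ((F.P K).sitesPerDir 0)))) ν - 1
                ∨ y ν = (iterBlockOf (K - n) (fun κ => z κ - (((((F.P K).L ^ (K - n) - 1) / 2 : ℕ)) : ZMod ((F.P K).sitesPerDir 0)))) ν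
                ∨ y ν = (iterBlockOf (K - n) (fun κ => z κ - (((((F.P K).L ^ (K - n) - 1) / 2 : ℕ)) : ZMod ((F.P K).sitesPerDir 0)))) ν + 1
                ∨ y ν = (iterBlockOf (K - n) (fun κ => z κ - (((((F.P K).L ^ (K - n) - 1) / 2 : ℕ)) : ZMod ((F.P K).sitesPerDir 0)))) ν + 2))
              then ‖divB (torusT (F.P K) 0) (fun κ z => unitsField (toUField W) ⟨z, κ⟩)
                (fun μ => covD (torusT (F.P K) 0) (fun κ z => unitsField (toUField W) ⟨z, κ⟩) μ (Ψ y)) z‖ ^ 2 else 0))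
                ≤ ζ_R * (∑ p : Plaq (F.P K) 0, ‖((Complex.I • D ⟨p.src, p.μ⟩) + ((W ⟨p.src, p.μ⟩ : Matrix (Fin 2) (Fin 2) ℂ) * (Complex.I • D ⟨p.src.shift p.μ, p.ν⟩) * star (W ⟨p.src, p.μ⟩ : Matrix (Fin 2) (Fin 2) ℂ))
            - (((W ⟨p.src, p.μ⟩ * W ⟨p.src.shift p.μ, p.ν⟩ * (W ⟨p.src.shift p.ν, p.μ⟩)⁻¹ : Matrix.specialUnitaryGroup (Fin 2) ℂ) : Matrix (Fin 2) (Fin 2) ℂ) * (Complex.I • D ⟨p.src.shift p.ν, p.μ⟩) * star ((W ⟨p.src, p.μ⟩ * W ⟨p.src.shift p.μ, p.ν⟩ * (W ⟨p.src.shift p.ν, p.μ⟩)⁻¹ : Matrix.specialUnitaryGroup (Fin 2) ℂ) : Matrix (Fin 2) (Fin 2) ℂ))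
            - (((GaugeField.plaqHol W p : Matrix.specialUnitaryGroup (Fin 2) ℂ) : Matrix (Fin 2) (Fin 2) ℂ) * (Complex.I • D ⟨p.src, p.ν⟩) * star ((GaugeField.plaqHol W p : Matrix.specialUnitaryGroup (Fin 2) ℂ) : Matrix (Fin 2) (Fin 2) ℂ)))‖ ^ 2) + θ_R * e * (((F.L : ℝ) ^ (K - n)) ^ 2)⁻¹ * (∑ b : PBond (F.P K) 0, ‖D b‖ ^ 2) ∧
              2 * (3 * (2 * ((F.P K).d : ℝ) * (6 / ((((F.P K).L ^ (K - n) : ℕ) : ℝ)))) * (3 / ((((F.P K).L ^ (K - n) : ℕ) : ℝ))))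
                  * (∑ y : Site (F.P K) (K - n), ∑ z : Site (F.P K) 0,
              (if (∀ ν : Fin (F.P K).d,
                  (y ν = (iterBlockOf (K - n) (fun κ => z κ - (((((F.P K).L ^ (K - n) - 1) / 2 : ℕ)) : ZMod ((F.P K).sitesPerDir 0)))) ν - 1
                  ∨ y ν = (iterBlockOf (K - n) (fun κ => z κ - (((((F.P K).L ^ (K - n) - 1) / 2 : ℕ)) : ZMod ((F.P K).sitesPerDir 0)))) ν
                  ∨ y ν = (iterBlockOf (K - n) (fun κ => z κ - (((((F.P K).L ^ (K - n) - 1) / 2 : ℕ)) : ZMod ((F.P K).sitesPerDir 0)))) ν + 1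
                  ∨ y ν = (iterBlockOf (K - n) (fun κ => z κ - (((((F.P K).L ^ (K - n) - 1) / 2 : ℕ)) : ZMod ((F.P K).sitesPerDir 0)))) ν + 2))
                then ∑ μ : Fin (F.P K).d,
                  (‖covDstar (torusT (F.P K) 0) (fun κ z => unitsField (toUField W) ⟨z, κ⟩) μ (Ψ y) z‖ ^ 2
                    + ‖covD (torusT (F.P K) 0) (fun κ z => unitsField (toUField W) ⟨z, κ⟩) μ (Ψ y) z‖ ^ 2) else 0))
                ≤ ζ_D * (∑ p : Plaq (F.P K) 0, ‖((Complex.I • D ⟨p.src, p.μ⟩) + ((W ⟨p.src, p.μ⟩ : Matrix (Fin 2) (Fin 2) ℂ) * (Complex.I • D ⟨p.src.shift p.μ, p.ν⟩) * star (W ⟨p.src, p.μ⟩ : Matrix (Fin 2) (Fin 2) ℂ))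
            - (((W ⟨p.src, p.μ⟩ * W ⟨p.src.shift p.μ, p.ν⟩ * (W ⟨p.src.shift p.ν, p.μ⟩)⁻¹ : Matrix.specialUnitaryGroup (Fin 2) ℂ) : Matrix (Fin 2) (Fin 2) ℂ) * (Complex.I • D ⟨p.src.shift p.ν, p.μ⟩) * star ((W ⟨p.src, p.μ⟩ * W ⟨p.src.shift p.μ, p.ν⟩ * (W ⟨p.src.shift p.ν, p.μ⟩)⁻¹ : Matrix.specialUnitaryGroup (Fin 2) ℂ) : Matrix (Fin 2) (Fin 2) ℂ))
            - (((GaugeField.plaqHol W p : Matrix.specialUnitaryGroup (Fin 2) ℂ) : Matrix (Fin 2) (Fin 2) ℂ) * (Complex.I • D ⟨p.src, p.ν⟩) * star ((GaugeField.plaqHol W p : Matrix.specialUnitaryGroup (Fin 2) ℂ) : Matrix (Fin 2) (Fin 2) ℂ)))‖ ^ 2) + θ_D * e * (((F.L : ℝ) ^ (K - n)) ^ 2)⁻¹ * (∑ b : PBond (F.P K) 0, ‖D b‖ ^ 2) ∧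
              2 * (3 * ((F.P K).d : ℝ) ^ 2 * (24 / ((((F.P K).L ^ (K - n) : ℕ) : ℝ)) ^ 2)
            * (24 / ((((F.P K).L ^ (K - n) : ℕ) : ℝ)) ^ 2 * ((((F.P K).L ^ (K - n) : ℕ) : ℝ)) ^ (F.P K).d))
                  * (∑ y : Site (F.P K) (K - n), G y ^ 2)
                ≤ C_H * ((F.L : ℝ) ^ (K - n))⁻¹ * (∑ c : PBond (F.P K) (K - n), ∑ a : Fin 2, ∑ b : Fin 2,
                Complex.normSq ((φ₀ (embIter (K - n) c.src) - ((Averaging.iter (fun i => blockAvg (P := F.P K) (j := i) (expMeanLogSU (n := Fin 2))) (K - n) W c : Matrix.specialUnitaryGroup (Fin 2) ℂ) : Matrix (Fin 2) (Fin 2) ℂ)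
                    * φ₀ (embIter (K - n) c.tgt) * star ((Averaging.iter (fun i => blockAvg (P := F.P K) (j := i) (expMeanLogSU (n := Fin 2))) (K - n) W c : Matrix.specialUnitaryGroup (Fin 2) ℂ) : Matrix (Fin 2) (Fin 2) ℂ)) a b))
                  + ζ_G * (∑ p : Plaq (F.P K) 0, ‖((Complex.I • D ⟨p.src, p.μ⟩) + ((W ⟨p.src, p.μ⟩ : Matrix (Fin 2) (Fin 2) ℂ) * (Complex.I • D ⟨p.src.shift p.μ, p.ν⟩) * star (W ⟨p.src, p.μ⟩ : Matrix (Fin 2) (Fin 2) ℂ))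
            - (((W ⟨p.src, p.μ⟩ * W ⟨p.src.shift p.μ, p.ν⟩ * (W ⟨p.src.shift p.ν, p.μ⟩)⁻¹ : Matrix.specialUnitaryGroup (Fin 2) ℂ) : Matrix (Fin 2) (Fin 2) ℂ) * (Complex.I • D ⟨p.src.shift p.ν, p.μ⟩) * star ((W ⟨p.src, p.μ⟩ * W ⟨p.src.shift p.μ, p.ν⟩ * (W ⟨p.src.shift p.ν, p.μ⟩)⁻¹ : Matrix.specialUnitaryGroup (Fin 2) ℂ) : Matrix (Fin 2) (Fin 2) ℂ))
            - (((GaugeField.plaqHol W p : Matrix.specialUnitaryGroup (Fin 2) ℂ) : Matrix (Fin 2) (Fin 2) ℂ) * (Complex.I • D ⟨p.src, p.ν⟩) * star ((GaugeField.plaqHol W p : Matrix.specialUnitaryGroup (Fin 2) ℂ) : Matrix (Fin 2) (Fin 2) ℂ)))‖ ^ 2) + θ_G * e * (((F.L : ℝ) ^ (K - n)) ^ 2)⁻¹ * (∑ b : PBond (F.P K) 0, ‖D b‖ ^ 2)) ∧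
            -- ROW (P) (DISPLAYED, booked): the covariant face-flux ∕ Poincaré row with the free-θ mass term
            (∑ c : PBond (F.P K) (K - n), ∑ a : Fin 2, ∑ b : Fin 2,
                Complex.normSq ((φ₀ (embIter (K - n) c.src) - ((Averaging.iter (fun i => blockAvg (P := F.P K) (j := i) (expMeanLogSU (n := Fin 2))) (K - n) W c : Matrix.specialUnitaryGroup (Fin 2) ℂ) : Matrix (Fin 2) (Fin 2) ℂ)
                    * φ₀ (embIter (K - n) c.tgt) * star ((Averaging.iter (fun i => blockAvg (P := F.P K) (j := i) (expMeanLogSU (n := Fin 2))) (K - n) W c : Matrix.specialUnitaryGroup (Fin 2) ℂ) : Matrix (Fin 2) (Fin 2) ℂ)) a b))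
              ≤ ((F.L : ℝ) ^ (K - n)) * (ζ_P / θ) * (∑ p : Plaq (F.P K) 0, ‖((Complex.I • D ⟨p.src, p.μ⟩) + ((W ⟨p.src, p.μ⟩ : Matrix (Fin 2) (Fin 2) ℂ) * (Complex.I • D ⟨p.src.shift p.μ, p.ν⟩) * star (W ⟨p.src, p.μ⟩ : Matrix (Fin 2) (Fin 2) ℂ))
            - (((W ⟨p.src, p.μ⟩ * W ⟨p.src.shift p.μ, p.ν⟩ * (W ⟨p.src.shift p.ν, p.μ⟩)⁻¹ : Matrix.specialUnitaryGroup (Fin 2) ℂ) : Matrix (Fin 2) (Fin 2) ℂ) * (Complex.I • D ⟨p.src.shift p.ν, p.μ⟩) * star ((W ⟨p.src, p.μ⟩ * W ⟨p.src.shift p.μ, p.ν⟩ * (W ⟨p.src.shift p.ν, p.μ⟩)⁻¹ : Matrix.specialUnitaryGroup (Fin 2) ℂ) : Matrix (Fin 2) (Fin 2) ℂ))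
            - (((GaugeField.plaqHol W p : Matrix.specialUnitaryGroup (Fin 2) ℂ) : Matrix (Fin 2) (Fin 2) ℂ) * (Complex.I • D ⟨p.src, p.ν⟩) * star ((GaugeField.plaqHol W p : Matrix.specialUnitaryGroup (Fin 2) ℂ) : Matrix (Fin 2) (Fin 2) ℂ)))‖ ^ 2)
                + θ * ((F.L : ℝ) ^ (K - n))⁻¹ * (∑ b : PBond (F.P K) 0, ‖D b‖ ^ 2)
                + θ_P * e * ((F.L : ℝ) ^ (K - n))⁻¹ * (∑ b : PBond (F.P K) 0, ‖D b‖ ^ 2)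
                + C_P * ((F.L : ℝ) ^ (K - n)) * (∑ b : PBond (F.P K) 0, ∑ ν : Fin (F.P K).d,
                ‖((W ⟨b.src, ν⟩ : Matrix.specialUnitaryGroup (Fin 2) ℂ) : Matrix (Fin 2) (Fin 2) ℂ) * B ⟨b.src.shift ν, b.dir⟩ * star ((W ⟨b.src, ν⟩ : Matrix.specialUnitaryGroup (Fin 2) ℂ) : Matrix (Fin 2) (Fin 2) ℂ) - B b‖ ^ 2)
                + C_Λ * ((F.L : ℝ) ^ (K - n)) * (∑ x : Site (F.P K) 0, ∑ μ : Fin (F.P K).d, ∑ ν : Fin (F.P K).d,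
                (if μ < ν then ∑ j : Fin 2, ∑ k : Fin 2, ‖(curl (torusT (F.P K) 0) (fun κ z => unitsField (toUField W) ⟨z, κ⟩) (fun κ z => B ⟨z, κ⟩) μ ν x) j k‖ ^ 2 else 0)))) :
    ∀ (L : ℕ), 1 < L → ∀ (B₃ : ℝ), 4 < B₃ →
    ∃ e₅ a₁'' : ℝ, 0 < e₅ ∧ 0 < a₁'' ∧ ∀ (i : Idx L) (e ε₁ : ℝ) (V : GaugeField (i.1.1.P i.1.2.1) 0 (Matrix.specialUnitaryGroup (Fin 2) ℂ))
      (U₀ W : GaugeField (i.1.1.P i.1.2.2) 0 (Matrix.specialUnitaryGroup (Fin 2) ℂ)),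
      0 < ε₁ → ε₁ ≤ a₁'' → PlaqSmall ε₁ V → (L : ℝ) ^ 3 * B₃ * ε₁ ≤ e → e ≤ e₅ →
      RegPr i.1.1 i.1.2.1 i.1.2.2 ((L : ℝ) ^ 3 * B₃ * ε₁) U₀ → CloseAvg i.1.1 i.1.2.1 i.1.2.2 i.2.2.le ((L : ℝ) ^ 3 * ε₁) V U₀ →
      W ∈ regFibrePr i.1.1 i.1.2.1 i.1.2.2 i.2.2.le e V → IsCritR2 i.1.1 i.1.2.1 i.1.2.2 i.2.2.le V W →
        IsMinOn (fun W' : GaugeField (i.1.1.P i.1.2.2) 0 (Matrix.specialUnitaryGroup (Fin 2) ℂ) => wilsonAction4 W')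
          (regFibrePr i.1.1 i.1.2.1 i.1.2.2 i.2.2.le e V) W := by
  refine stub_PV3E_of_pinnedSliceAndEngineRows ?_
  intro L hL
  obtain ⟨e₆, sQ, ζ, δ₁, he₆, he₆L, hsQ0, hsQ8, hsQL, hζ0, hδ0, hδκ, hwin1, hwin2, hE1,
    C_H, ζ_R, θ_R, ζ_D, θ_D, ζ_G, θ_G, ζ_P, θ, θ_P, C_P, C_Λ, C_g, θ_g,
    hCH, hθR, hθD, hθG, hθ, hθP, hCP, hCΛ, hθg, hζ, hδ, H⟩ := hrows L hL
  refine ⟨e₆, sQ, ζ, δ₁, he₆, he₆L, hsQ0, hsQ8, hsQL, hζ0, hδ0, hδκ, hwin1, hwin2, hE1,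
    C_H, ζ_R + ζ_D + ζ_G, θ_R + θ_D + θ_G, ζ_P, θ, θ_P, C_P, C_Λ, 16 * (1 + C_g), 16 * θ_g + 792,
    hCH, by positivity, hθ, hθP, hCP, hCΛ, by positivity, hζ, hδ, ?_⟩
  intro F hF n K hnK e V W he hhe hW hWcrit Y hY hsup hSH D hD B φ₀ hsplit hBc
  obtain ⟨hKg, ⟨Ψ, Z, G, hΨ, hG, hRes, hDir, hGJ⟩, hP⟩ := H F hF n K hnK e V W he hhe hW hWcrit Y hY hsup hSH D hD B φ₀ hsplit hBc
  -- member arithmetic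
  have hL1 : 1 < F.L := F.hL.2
  have hKn : K - n ≠ 0 := by omega
  have hk : K - n ≤ (F.P K).m + (F.P K).K := by
    show K - n ≤ F.m + K
    omega
  have hℓ2 : 2 ≤ (F.P K).L ^ (K - n) := by
    show 2 ≤ F.L ^ (K - n)
    have := Nat.one_lt_pow hKn hL1
    omega
  -- `e ≤ 1` from the window `10¹⁴L⁹e₆ ≤ 1`
  have hFL : (F.L : ℝ) = (L : ℝ) := by exact_mod_cast hF
  have hL1r : (1 : ℝ) ≤ (L : ℝ) := by exact_mod_cast hL.le
  have he1 : e ≤ 1 := by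
    have h9 : (1 : ℝ) ≤ (L : ℝ) ^ 9 := one_le_pow₀ hL1r
    nlinarith
  -- `S_H` letter ⇒ LEMMA-H's biharmonic letter for `φ₀`
  have hSH' : ∀ x : Site (F.P K) 0, x ∉ Set.range (embIter (K - n)) →
      divB (torusT (F.P K) 0) (fun κ z => unitsField (toUField W) ⟨z, κ⟩) (fun μ z => covD (torusT (F.P K) 0) (fun κ z => unitsField (toUField W) ⟨z, κ⟩) μ
        (fun y => divB (torusT (F.P K) 0) (fun κ z => unitsField (toUField W) ⟨z, κ⟩) (fun κ z => Complex.I • D ⟨z, κ⟩) y) z) x = 0 := by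
    subst hD
    exact hSH
  have hψ : ∀ x : Site (F.P K) 0, x ∉ Set.range (embIter (K - n)) →
      divB (torusT (F.P K) 0) (fun κ z => unitsField (toUField W) ⟨z, κ⟩) (fun κ y => covD (torusT (F.P K) 0) (fun κ z => unitsField (toUField W) ⟨z, κ⟩) κ
        (fun z => divB (torusT (F.P K) 0) (fun κ z => unitsField (toUField W) ⟨z, κ⟩) (fun ν w => covD (torusT (F.P K) 0) (fun κ z => unitsField (toUField W) ⟨z, κ⟩) ν φ₀ w) z) y) x = 0 :=
    fun x hx => covLapLap_eq_zero_of_split (fun κ z => unitsField (toUField W) ⟨z, κ⟩) D B φ₀ hsplit hBc x (hSH' x hx)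
  refine ⟨?_, hP, ?_⟩
  · -- ROW (H) by ✓`rowH_of_localModelRows`
    exact rowH_of_localModelRows F K n hk hℓ2 W φ₀ hψ ⟨Ψ, Z, G, hΨ, hG, hRes, hDir, hGJ⟩
  · -- ROW (B) by px12's ✓`rowB_of_hKgK_T3`
    have hKg' := hKg (fun b => covD (torusT (F.P K) 0) (fun κ z => unitsField (toUField W) ⟨z, κ⟩) b.dir φ₀ b.src) (fun _ => rfl)
    exact rowB_of_hKgK_T3 F K n W he.le he1 (dist1_plaqHol_le_of_mem_regFibrePr F hnK.le hW) D B φ₀ hsplit hBc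
      (fun b => covD (torusT (F.P K) 0) (fun κ z => unitsField (toUField W) ⟨z, κ⟩) b.dir φ₀ b.src) (fun _ => rfl) hKg'

end Summit.QuantumFields.YangMills.Theorems.Prop7PV3EOfPinnedSliceAndRawRows

end
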